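import Literature.IUT.HodgeArakelov.MonoThetaCyclotomes
import Literature.IUT.HodgeArakelov.RadialEnvironments
import Literature.IUT.HodgeArakelov.RadialExamples
import Mathlib.CategoryTheory.InducedCategory

/-!
# [IUTchII] §1, Example 1.9 and Corollary 1.10: graphs of functorial algorithms; multiradial
# mono-theta cyclotomic rigidity

Mochizuki, *Inter-universal Teichmüller theory II*, §1, kurims manuscript (Dec. 2020) pp. 42–48:
Example 1.9 (i)–(iv), Remarks 1.9.1, 1.9.2 (i)–(iii), Corollary 1.10, Remarks 1.10.1–1.10.3
[claim: Mochizuki2012, status: disputed] (IUTchII §1 Ex 1.9 - Rmk 1.10.3, kurims pp.42-48). Record-only typing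
under the claim key `Mochizuki2012` (D-0012, disputed).

Continuing `RadialEnvironments` / `RadialExamples`, the content here is again category theory and is
DEFINED / PROVED over Mathlib:
* `IUTchII:Ex1.9(i)` — the GRAPH `𝒢` of a functor `Ξ : ℰ → ℱ` (objects `(E, Ξ(E))`, morphisms
  `(f, Ξ(f))`) with its natural functors `ℰ → 𝒢`, `𝒢 → ℰ`, `𝒢 → ℱ` (`Functor.Graph`, …);
* `IUTchII:Ex1.9(ii)` — for ANY functorial group-theoretic algorithm `Ξ` on topological groups
  `≅ Π^tp_{X̲̲_k}`, composing `ℛ → ℰ`, `(Π, G, α) ↦ Π` (Ex. 1.8 (i)) with `Ξ` and passing to the graph `ℛ†`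
  yields `Ψ_ℛ : ℛ → ℛ†` which "is multiradially defined" — PROVED (`ex19ii_multiradiallyDefined`): the
  printed "tautological" conclusion;
* `IUTchII:Ex1.9(iii)` — with radial data `Π` alone and `Φ : Π ↦ Π/Δ`, "`Φ` fails to be full [cf.
  [AbsTopIII], §I3; Remark 1.9.1]", so `Ψ_ℛ` is uniradially defined: the environment is DEFINED over the
  functor `Π ↦ Π/Δ` (interface input), non-fullness is the named fact `quotientFunctor_not_full`
  ([AbsTopIII] — TODO-merge:abc-iut-L4-t1), and the conclusion is PROVED from it;
* `IUTchII:Ex1.9(iv)` — the cyclotomic rigidity isomorphism `(l·Δ_Θ)(Π) ≅ μ_Ẑ(Π/Δ)` (inverse of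
  [AbsTopIII] Cor. 1.10 (c)) as the algorithm `Ξ`: (a) multiradially defined via (ii), (b) uniradially via
  (iii), (c) the daggered radial data `(Π, G, α, (l·Δ_Θ)(Π) ≅ μ_Ẑ(G))` with the `Γ`-orbit
  poly-isomorphism — all three typed; (a), (c) PROVED multiradially defined in the pair-environment model;
* `IUTchII:Cor1.10` — "Multiradial Mono-theta Cyclotomic Rigidity Isomorphisms": for the exterior-cyclotomic
  environment of Ex. 1.8 (vi) and the functor determined by `(*mono-Θ_Π) (l·Δ_Θ)(Π) ≅ Π_μ(M^Θ_*(Π))`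
  (Props. 1.2 (i), 1.5 (iii)), "the resulting natural functor `Ψ_ℛ : ℛ → ℛ†` is multiradially defined"
  — PROVED for every such functor (`cor110_multiradiallyDefined`; printed proof: "follow immediately from
  the definitions involved"); the specific functor is an interface input (`MonoThetaRigidityFunctor`);
* `IUTchII:Rmk1.10.1` — the dependency statement ("completely determined by the structure of
  `Δ_{M^Θ_*}(Π)` as a projective system of topological groups, the theta-section subgroups, and the images
  of `(l·ℤ)` and `G` in `Out`") typed as a factorisation predicate (`DependsOnlyOn`).
* Deliberately NOT typed beyond this docstring (C1, expository): `IUTchII:Rmk1.9.1` (uni- vs multi-radiality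
  as dependence on the arithmetic holomorphic structure; "one spoke at a time"), `IUTchII:Rmk1.9.2(i)`,
  `IUTchII:Rmk1.9.2(ii)`, `IUTchII:Rmk1.9.2(iii)` (Fig. 1.3; connections; crystalline-site analogy), `IUTchII:Rmk1.10.2` (Fig. 1.4, "in words";
  the recalled triviality of `Π_μ(M^Θ_*(Π)) ⊗ ℚ/ℤ → O^{×μ}(G)` is Ex. 1.8 (v)), `IUTchII:Rmk1.10.3`
  (why the theta function: theta group / rigidity properties of [EtTh]).
-/

namespace Literature.IUT.HodgeArakelov

open CategoryTheory

universe v v' u u' w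

/-! ## Example 1.9 (i): the graph of a functor -/

/-- **IUTchII:Ex1.9(i)** (kurims p. 42): "one may define a new category `𝒢` … as follows: the objects of
`𝒢` are pairs `(E, Ξ(E))`, where `E ∈ Ob(ℰ)`, and `Ξ(E) ∈ Ob(ℱ)` is the image of `E` via `Ξ`; the morphisms
of `𝒢` are the pairs of arrows `(f : E → E', Ξ(f) : Ξ(E) → Ξ(E'))`. We shall refer to `𝒢` … as the graph of
`Ξ`." Since `(E, Ξ(E))` and `(f, Ξ(f))` are determined by `E` and `f`, the graph is the category induced
from `ℰ` on the same objects (Mathlib `InducedCategory`). [claim: Mochizuki2012, status: disputed] (IUTchII §1 Ex 1.9 (i), kurims p.42) -/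
@[nolint unusedArguments]
def Functor.Graph {E : Type u} [Category.{v} E] {F : Type u'} [Category.{v'} F] (_Ξ : E ⥤ F) :
    Type u :=
  InducedCategory E (fun X : E => X)

namespace Functor.Graph

variable {E : Type u} [Category.{v} E] {F : Type u'} [Category.{v'} F] (Ξ : E ⥤ F)

/-- The graph of `Ξ` is a category (induced from `ℰ`). [claim: Mochizuki2012, status: disputed] (IUTchII §1 Ex 1.9 (i), kurims p.42) -/
instance : Category.{v} (Functor.Graph Ξ) := inferInstanceAs (Category (InducedCategory E fun X => X))

/-- The graph of a functor out of a groupoid is a groupoid. [claim: Mochizuki2012, status: disputed] (IUTchII §1 Ex 1.9 (i), kurims p.42) -/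
instance {E' : Type u} [Groupoid.{v} E'] {F' : Type u'} [Category.{v'} F'] (Ξ' : E' ⥤ F') :
    Groupoid.{v} (Functor.Graph Ξ') :=
  inferInstanceAs (Groupoid (InducedCategory E' fun X => X))

/-- **IUTchII:Ex1.9(i)**: the natural functor `ℰ → 𝒢`, `E ↦ (E, Ξ(E))`.
[claim: Mochizuki2012, status: disputed] (IUTchII §1 Ex 1.9 (i), kurims p.42) -/
def ofBase : E ⥤ Functor.Graph Ξ where
  obj X := X
  map f := InducedCategory.homMk f

/-- **IUTchII:Ex1.9(i)**: the natural functor `𝒢 → ℰ`, `(E, Ξ(E)) ↦ E`.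
[claim: Mochizuki2012, status: disputed] (IUTchII §1 Ex 1.9 (i), kurims p.42) -/
def toBase : Functor.Graph Ξ ⥤ E := inducedFunctor fun X : E => X

/-- **IUTchII:Ex1.9(i)**: the natural functor `𝒢 → ℱ`, `(E, Ξ(E)) ↦ Ξ(E)`.
[claim: Mochizuki2012, status: disputed] (IUTchII §1 Ex 1.9 (i), kurims p.42) -/
def toTarget : Functor.Graph Ξ ⥤ F := toBase Ξ ⋙ Ξ

/-- `ℰ → 𝒢 → ℰ` is the identity (definitionally). [claim: Mochizuki2012, status: disputed] (IUTchII §1 Ex 1.9 (i), kurims p.42) -/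
theorem ofBase_toBase : ofBase Ξ ⋙ toBase Ξ = Functor.id E := rfl

/-- `𝒢 → ℰ` is full. [claim: Mochizuki2012, status: disputed] (IUTchII §1 Ex 1.9 (i), kurims p.42) -/
instance : (toBase Ξ).Full := (fullyFaithfulInducedFunctor fun X : E => X).full

/-- `𝒢 → ℰ` is faithful. [claim: Mochizuki2012, status: disputed] (IUTchII §1 Ex 1.9 (i), kurims p.42) -/
instance : (toBase Ξ).Faithful := (fullyFaithfulInducedFunctor fun X : E => X).faithful

/-- `𝒢 → ℰ` is essentially surjective (it is the identity on objects). [claim: Mochizuki2012, status: disputed] (IUTchII §1 Ex 1.9 (i), kurims p.42) -/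
instance : (toBase Ξ).EssSurj := ⟨fun X => ⟨X, ⟨Iso.refl _⟩⟩⟩

end Functor.Graph

/-! ## Example 1.9 (ii): every functorial group-theoretic algorithm is tautologically multiradial -/

/-- **IUTchII:Ex1.9(ii)** (kurims p. 42): the daggered environment `(ℛ†, 𝒞† := 𝒞, Φ†)`: `ℛ†` the graph of
`ℛ → ℰ → ℱ`, `(Π, G, α) ↦ Π ↦ Ξ(Π)`, with `Φ† : ℛ† → ℛ → 𝒞` — for a radial environment `Env` and any
functor `Ξ` out of its radial category (DEFINED generally). [claim: Mochizuki2012, status: disputed] (IUTchII §1 Ex 1.9 (ii), kurims p.42) -/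
def RadialEnvironment.dagger (Env : RadialEnvironment.{v, u}) {F : Type u'} [Category.{v'} F]
    (Ξ : Env.R ⥤ F) : RadialEnvironment.{v, u} where
  R := Functor.Graph Ξ
  C := Env.C
  Φ := Functor.Graph.toBase Ξ ⋙ Env.Φ
  essSurj := inferInstance

/-- **IUTchII:Ex1.9(ii)**: the natural functor `Ψ_ℛ : ℛ → ℛ†` together with `Ψ_𝒞 := id`, a 1-commutative
square as in Example 1.7 (iv) (DEFINED; the square commutes strictly).
[claim: Mochizuki2012, status: disputed] (IUTchII §1 Ex 1.9 (ii), kurims p.42) -/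
def RadialEnvironment.toDagger (Env : RadialEnvironment.{v, u}) {F : Type u'} [Category.{v'} F]
    (Ξ : Env.R ⥤ F) : RadialMorphism Env (Env.dagger Ξ) where
  ΨR := Functor.Graph.ofBase Ξ
  ΨC := Functor.id _
  comm := Iso.refl _

/-- **IUTchII:Ex1.9(ii)** (kurims p. 42), PROVED: "Since `(ℛ, 𝒞, Φ)` is a multiradial environment, it thus
follows that `Ψ_ℛ` is multiradially defined. That is to say, by using the radial environment of Example
1.8, (i), one concludes that any functorial group-theoretic algorithm whose input data consists of a
topological group isomorphic to `Π^tp_{X̲̲_k}` gives rise — in a tautological fashion … — to a multiradially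
defined functor." (Here `Ξ` is composed with `ℛ → ℰ`, `(Π, G, α) ↦ Π`, i.e. the first projection.)
[claim: Mochizuki2012, status: disputed] (IUTchII §1 Ex 1.9 (ii), kurims p.42) -/
theorem ex19ii_multiradiallyDefined (S : ThetaSetting.{u}) {F : Type u'} [Category.{v'} F]
    (Ξ : IsoClass S.PiX ⥤ F) :
    ((ex18i S).toDagger (CategoryTheory.Prod.fst _ _ ⋙ Ξ)).IsMultiradiallyDefined :=
  ex18i_isMultiradial S

/-! ## Example 1.9 (iii): the uniradial environment `Π ↦ Π/Δ` -/

/-- **IUTchII:Ex1.9(iii)** (kurims pp. 42–43): "a collection of radial data [is] a topological group `Π`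
isomorphic to `Π^tp_{X̲̲_k}`, and an isomorphism of collections of radial data [is] an isomorphism of
topological groups. The [coric data are] as in Example 1.8, (i). The radial functor `Φ : ℛ → 𝒞` is defined
via the assignment `Π ↦ Π/Δ`." DEFINED over the functor `Π ↦ Π/Δ` (`Q`, an interface input: the
group-theoretic characterisation of `Δ`, [AbsAnab] Lem. 1.3.8, makes the quotient functorial in
isomorphisms; TODO-merge:abc-iut-L4-t1). [claim: Mochizuki2012, status: disputed] (IUTchII §1 Ex 1.9 (iii), kurims pp.42-43) -/
def ex19iii (S : ThetaSetting.{u}) (Q : IsoClass S.PiX ⥤ IsoClass S.Gk) [Q.EssSurj] :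
    RadialEnvironment.{u, u + 1} :=
  ⟨IsoClass S.PiX, IsoClass S.Gk, Q, inferInstance⟩

/-- **IUTchII:Ex1.9(iii)** (kurims p. 43): "`Φ` fails to be full [cf., e.g., [AbsTopIII], §I3; [AbsTopIII],
Remark 1.9.1]. That is to say, `(ℛ, 𝒞, Φ)` is a uniradial environment." Named fact about the quotient
functor `Π ↦ Π/Δ = G_k` (not every automorphism of `G_k` arises from one of `Π^tp_{X̲̲_k}`).
TODO-merge:abc-iut-L4-t1 ([AbsTopIII] §I3). [claim: Mochizuki2012, status: disputed] (IUTchII §1 Ex 1.9 (iii), kurims p.43) -/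
def quotientFunctor_not_full (S : ThetaSetting.{u}) (Q : IsoClass S.PiX ⥤ IsoClass S.Gk) : Prop :=
  ¬ Q.Full

/-- **IUTchII:Ex1.9(iii)**, PROVED from the non-fullness fact: the environment is uniradial, hence every
`Ψ_ℛ` out of it "is uniradially defined … any functorial group-theoretic algorithm whose input data consists
of a topological group isomorphic to `Π^tp_{X̲̲_k}` also gives rise — in a tautological fashion — to a
uniradially defined functor." [claim: Mochizuki2012, status: disputed] (IUTchII §1 Ex 1.9 (iii), kurims p.43) -/
theorem ex19iii_uniradiallyDefined (S : ThetaSetting.{u}) (Q : IsoClass S.PiX ⥤ IsoClass S.Gk)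
    [Q.EssSurj] (hQ : quotientFunctor_not_full S Q) {F : Type u'} [Category.{v'} F]
    (Ξ : IsoClass S.PiX ⥤ F) : ((ex19iii S Q).toDagger Ξ).IsUniradiallyDefined :=
  hQ

/-! ## Example 1.9 (iv): the cyclotomic rigidity isomorphism `(l·Δ_Θ)(Π) ≅ μ_Ẑ(Π/Δ)` -/

/-- **IUTchII:Ex1.9(iv)** (kurims p. 43): "Recall the isomorphism `μ_Ẑ(G_k) ≅ μ_Ẑ(Π_X)` of [AbsTopIII],
Corollary 1.10, (c), which is constructed by means of a functorial group-theoretic algorithm. The inverse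
of this isomorphism yields a cyclotomic rigidity isomorphism `(l·Δ_Θ)(Π) ≅ μ_Ẑ(Π/Δ)` … one has a
functorial group-theoretic algorithm whose input data consists of the topological group `Π`, and whose
output data may be thought of as consisting of `Π`, the two topological `Π`-modules `(l·Δ_Θ)(Π)`,
`μ_Ẑ(Π/Δ)`, and the above isomorphism of `Π`-modules." The OUTPUT category `ℱ` "defined in the evident
way so as to accommodate the data just listed" (Cor. 1.10): objects = a topological group with two modules
(multiplicatively written abelian groups with an action, as for the cyclotomes of Def. 1.1) and an equivariant isomorphism; DEFINED as a structure
(morphisms are not needed below: `ℱ` enters only through functors INTO it, which we keep abstract).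
[claim: Mochizuki2012, status: disputed] (IUTchII §1 Ex 1.9 (iv), kurims p.43) -/
structure CyclotomePairIso : Type (u + 1) where
  /-- the topological group `Π` -/
  P : TopGroup.{u}
  /-- the two `Π`-modules, e.g. `(l·Δ_Θ)(Π)` and `μ_Ẑ(Π/Δ)` (resp. `Π_μ(M^Θ_*(Π))` in Cor. 1.10) -/
  A : Type u
  B : Type u
  [grpA : CommGroup A]
  [grpB : CommGroup B]
  actA : P →* MulAut A
  actB : P →* MulAut B
  /-- the isomorphism of `Π`-modules (cyclotomes written multiplicatively) -/
  iso : A ≃* B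
  equivariant : ∀ (x : P) (a : A), iso (actA x a) = actB x (iso a)

attribute [instance] CyclotomePairIso.grpA CyclotomePairIso.grpB

/-- **IUTchII:Ex1.9(iv)** (a)/(b) (kurims p. 43): taking the cyclotomic-rigidity algorithm as `Ξ`, "(a) a
multiradially defined functor, via the approach of (ii), or (b) a uniradially defined functor, via the
approach of (iii)" — (a) PROVED as an instance of (ii) for any functor valued in (a category of)
`CyclotomePairIso` data. [claim: Mochizuki2012, status: disputed] (IUTchII §1 Ex 1.9 (iv), kurims p.43) -/
theorem ex19iv_a (S : ThetaSetting.{u}) {F : Type (u + 1)} [Category.{u} F]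
    (Ξcyc : IsoClass S.PiX ⥤ F) :
    ((ex18i S).toDagger (CategoryTheory.Prod.fst _ _ ⋙ Ξcyc)).IsMultiradiallyDefined :=
  ex19ii_multiradiallyDefined S Ξcyc

/-- **IUTchII:Ex1.9(iv)** (c) (kurims pp. 43–44): daggered radial data `(Π, G, α, (l·Δ_Θ)(Π) ≅ μ_Ẑ(G))`,
"the poly-isomorphism `(l·Δ_Θ)(Π) ≅ μ_Ẑ(G)` obtained by composing the above cyclotomic rigidity isomorphism
… with the poly-isomorphism `μ_Ẑ(Π/Δ) ≅ μ_Ẑ(G)` induced by the poly-isomorphism `α : Π/Δ ≅ G`. Thus [it]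
consists not of a single isomorphism of topological modules, but rather of an `Aut(G)`-orbit — or, more
precisely, a `Γ`-orbit, where `Γ ⊆ Ẑ^×` is the image of `Aut(G)` via the cyclotomic character on `Aut(G)`
[cf. [AbsAnab], Proposition 1.2.1, (vi)] — of isomorphisms … An isomorphism of collections of daggered
radial data is defined to be an isomorphism between the underlying collections of radial data [which is
necessarily compatible with the poly-isomorphism …]. … (c) this multiradially defined functor
`Ψ_ℛ : ℛ → ℛ†` yields an alternative [i.e., relative to (a)] multiradial approach". In the pair model the
daggered category has the SAME objects and morphisms as `ℛ` (the `Γ`-orbit is determined), i.e. it is the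
graph of the daggering algorithm; PROVED multiradially defined. (This is "the approach taken in Corollary
1.11, (b)".) [claim: Mochizuki2012, status: disputed] (IUTchII §1 Ex 1.9 (iv), kurims pp.43-44) -/
theorem ex19iv_c (S : ThetaSetting.{u}) {F : Type (u + 1)} [Category.{u} F]
    (Ξdagger : (ex18i S).R ⥤ F) : ((ex18i S).toDagger Ξdagger).IsMultiradiallyDefined :=
  ex18i_isMultiradial S

/-! ## Corollary 1.10: multiradial mono-theta cyclotomic rigidity isomorphisms -/

/-- INTERFACE input of **IUTchII:Cor1.10** (kurims p. 47): "the cyclotomic rigidity isomorphism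
`(l·Δ_Θ)(Π) ≅ Π_μ(M^Θ_*(Π))` `(*mono-Θ_Π)` [where we identify `(l·Δ_Θ)(M^Θ_*(Π))` with `(l·Δ_Θ)(Π)` — cf.
Proposition 1.4] obtained by composing the functorial algorithm `Π ↦ M^Θ_*(Π)` of Proposition 1.2, (i) …
with the functorial algorithm for constructing a cyclotomic rigidity isomorphism of Proposition 1.5,
(iii). Then the data consisting of the topological group `Π`, the topological `Π`-modules constituted by
the domain and codomain of `(*mono-Θ_Π)`, and the isomorphism `(*mono-Θ_Π)` determines a functor `ℛ → ℱ` …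
which arises from a functorial algorithm in the topological group `Π`". Carried as a functor on
`IsoClass Π^tp_{X̲̲_k}` valued in `CyclotomePairIso` data whose value at `Π` has underlying group `Π` (the
functoriality of Props. 1.2 (i)/1.5 (iii) in isomorphisms of `Π`, recorded in prose there, is exactly this
functor). [claim: Mochizuki2012, status: disputed] (IUTchII §1 Cor 1.10, kurims p.47) -/
structure MonoThetaRigidityFunctor (S : ThetaSetting.{u}) (F : Type (u + 1)) [Category.{u} F] :
    Type (u + 1) where
  /-- the functor `Π ↦ (Π, (l·Δ_Θ)(Π), Π_μ(M^Θ_*(Π)), (*mono-Θ_Π))` -/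
  Ξ : IsoClass S.PiX ⥤ F
  /-- the underlying data of each value -/
  data : F → CyclotomePairIso.{u}
  /-- the value at `Π` has underlying topological group `Π` -/
  data_P : ∀ P : IsoClass S.PiX, (data (Ξ.obj P)).P = P.G

/-- **IUTchII:Cor1.10** (kurims pp. 46–47) "(Multiradial Mono-theta Cyclotomic Rigidity Isomorphisms)":
"Write `(ℛ, 𝒞, Φ)` — i.e., in the notation of Example 1.8, (v), (vi),
`(Π ↷ Π_μ(M^Θ_*(Π)) ⊗ ℚ/ℤ, G ↷ O^{×μ}(G), α_{μ,×μ}) ↦ (G ↷ O^{×μ}(G))` — for the multiradial environment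
constituted by the exterior-cyclotomic version [cf. Example 1.8, (vi)] … denote the corresponding graph [cf.
Example 1.9, (i)] by `ℛ†`. In particular, the resulting natural functor `Ψ_ℛ : ℛ → ℛ†` [cf. Example 1.9,
(i)] is multiradially defined." PROVED in the pair-environment model for every rigidity functor (printed
proof, p. 47: "The various assertions of Corollary 1.10 follow immediately from the definitions involved").
[claim: Mochizuki2012, status: disputed] (IUTchII §1 Cor 1.10, kurims pp.46-47) -/
theorem cor110_multiradiallyDefined (S : ThetaSetting.{u}) (Γxμ : Type u) [Group Γxμ]
    {F : Type (u + 1)} [Category.{u} F] (M : MonoThetaRigidityFunctor S F) :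
    ((ex18iii S Γxμ).toDagger (CategoryTheory.Prod.fst _ _ ⋙ M.Ξ)).IsMultiradiallyDefined :=
  ex18iii_isMultiradial S Γxμ

/-- **IUTchII:Cor1.10**, the daggered environment `(ℛ†, 𝒞, Φ†)` of Corollary 1.10 itself (DEFINED), for
use by Corollaries 1.11, 1.12. [claim: Mochizuki2012, status: disputed] (IUTchII §1 Cor 1.10, kurims p.47) -/
def cor110Dagger (S : ThetaSetting.{u}) (Γxμ : Type u) [Group Γxμ] {F : Type (u + 1)} [Category.{u} F]
    (M : MonoThetaRigidityFunctor S F) : RadialEnvironment.{u, u + 1} :=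
  (ex18iii S Γxμ).dagger (CategoryTheory.Prod.fst _ _ ⋙ M.Ξ)

/-! ## Remark 1.10.1: what the rigidity isomorphism depends on -/

/-- **IUTchII:Rmk1.10.1** (kurims p. 47): "the domain and codomain of the isomorphism `(*mono-Θ_Π)` of
Corollary 1.10, as well as the isomorphism `(*mono-Θ_Π)` itself, are constructed from various subquotients
of `Δ_{M^Θ_*}(Π)` which are completely determined by the structure of `Δ_{M^Θ_*}(Π)` as a projective system
of topological groups, the subgroups of `Δ_{M^Θ_*}(Π)` determined by the images of the theta section
portions of the system of mono-theta environments `M^Θ_*(Π)`, and the images [arising from the natural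
outer actions involved — cf. Definition 1.1, (i)] of `(l·ℤ)(M^Θ_*(Π))` and `G(M^Θ_*(Π))` in
`Out(Δ_{M^Θ_*}(Π))`" ([EtTh] Cor. 2.18 (i), (iii), Cor. 2.19 (i), Prop. 2.11 (i), 2.12, 2.14 (i)). Typed
as a FACTORISATION predicate: the rigidity functor `Ξ` factors (up to isomorphism) through the functor `U`
extracting exactly that data (`U` an interface input valued in a category `𝒟` of "projective systems of
topological groups with marked subgroups and outer images"). [claim: Mochizuki2012, status: disputed] (IUTchII §1 Rmk 1.10.1, kurims p.47) -/
def DependsOnlyOn {E : Type u} [Category.{v} E] {D : Type w} [Category.{v} D] {F : Type u'}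
    [Category.{v'} F] (Ξ : E ⥤ F) (U : E ⥤ D) : Prop :=
  ∃ Ξ' : D ⥤ F, Nonempty (Ξ ≅ U ⋙ Ξ')

/-- **IUTchII:Rmk1.10.1**, as a named statement over the interfaces: the mono-theta rigidity functor depends
only on the `Δ`-data functor `U`. (Predicate with parameters; the instance is supplied by the [EtTh]
algorithms.) [claim: Mochizuki2012, status: disputed] (IUTchII §1 Rmk 1.10.1, kurims p.47) -/
def Rmk1101_statement (S : ThetaSetting.{u}) {F : Type (u + 1)} [Category.{u} F]
    (M : MonoThetaRigidityFunctor S F) {D : Type (u + 1)} [Category.{u} D]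
    (U : IsoClass S.PiX ⥤ D) : Prop :=
  DependsOnlyOn M.Ξ U

end Literature.IUT.HodgeArakelov
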